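import Literature.NumberTheory.EllipticCurves.TateCurve.Invariants
import Literature.NumberTheory.EllipticCurves.SteinWuthrich2013.PadicExpLogCoshProofs
import HarnessLib

/-!
# Uniform/UI/O2 — `p`-adic unit lemmas behind the valuation of the Tate–sigma value

HONEST FRAMING (cell `bsd-uniform`, seat `ui-o2`, gen 5): THEOREMS ONLY — elementary `p`-adic analysis in
`ℚ_p` for `p` odd; no definition, no named fact, no `sorry`; nothing in this file is about BSD, books
anything or moves a census mark. It is the lemma file of `Uniform/UI/O2SigmaValuation.lean`, which proves
the pre-registered structure test P3 of `HOME/ui/O2-CONJECTURE.md` §4 ("`v₃(Σ²(Q)) = 2·v₃(z(Q))`") as a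
theorem; the section numbers below are shared with that file.

* §1 ultrametric bookkeeping: `‖1 + a‖_p = 1` for `‖a‖_p < 1`; `‖∏' f‖_p = 1` as soon as every factor
  has norm `1` (convergent or not — a non-multipliable `tprod` is `1`).
* §3 the even exponential series `ch(w) = Σ wⁿ/(2n)!` (`SteinWuthrich2013.coshOfSq`, the device through
  which the tree's transcription of Stein–Wuthrich §4.2 writes `(u + u⁻¹)/2 = ch(log_p(u)²)`): for
  `‖L‖_p ≤ p⁻²`, `p` odd, `ch(L) = 1 + L/2 + R` with `‖R‖_p ≤ ‖L‖_p/p` (Legendre: `v_p((2n)!) ≤ n − 1`),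
  hence `‖ch(L)‖_p = 1` and **`‖2(ch(L) − 1)‖_p = ‖L‖_p`** (`norm_two_mul_coshOfSq_sub_one`); the
  factorial norms and `exp_p`-radius facts are the tree's (`SteinWuthrich2013.norm_inv_factorial`,
  `PadicExpLogCoshProofs`).
* §4 the `q`-product of `σ_q(u)² = 2(c − 1)·∏_{n≥1}(1 − 2qⁿc + q²ⁿ)²/(1 − qⁿ)⁴`
  (`SteinWuthrich2013.tateSigmaSq`) is a unit for `‖q‖_p < 1`, `‖c‖_p ≤ 1`:
  **`‖tateSigmaSq q c‖_p = ‖2(c − 1)‖_p`** (`norm_tateSigmaSq_eq`).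

(§2, the uniformisation scale, §5, `‖log_E(z)‖_p = ‖z‖_p` — the tree's
`Rank1Residual.O5.HeegnerLogTransport.norm_padicFormalLog_eq_of_norm_le_inv` —, and §6–§7, the theorem
and its corollaries, are in / used by the sibling file.)

References: [SteinWuthrich2013] §4.2; [Gouvea1993PadicNumbers] §5.7 (Legendre's bound);
`HOME/ui/O2-CONJECTURE.md` §4 (test P3) and §10 (this generation's record).
-/

noncomputable section

open scoped Classical Nat
open Filter Topology IsUltrametricDist PowerSeries
open WeierstrassCurve Literature.NumberTheory.EllipticCurves
open Literature.NumberTheory.EllipticCurves.SteinWuthrich2013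

namespace Summit.BirchSwinnertonDyer.Uniform.UI.O2

variable {p : ℕ} [hp : Fact p.Prime]

/-! ### §1 Ultrametric bookkeeping in `ℚ_p` -/

/-- `‖1 + a‖_p = 1` for `‖a‖_p < 1`. [folklore] -/
theorem norm_one_add_eq_one_of_norm_lt_one {a : ℚ_[p]} (ha : ‖a‖ < 1) : ‖1 + a‖ = 1 := by
  have h := norm_add_eq_max_of_norm_ne_norm (x := (1 : ℚ_[p])) (y := a)
    (by rw [norm_one]; exact ha.ne')
  rw [h, norm_one, max_eq_left ha.le]

/-- `‖∏' n, f n‖_p = 1` as soon as every factor has norm `1` — whether or not the product converges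
(a non-multipliable `tprod` is `1` by convention). [folklore] -/
theorem norm_tprod_eq_one_of_forall_norm_eq_one {f : ℕ → ℚ_[p]} (hf : ∀ n, ‖f n‖ = 1) :
    ‖∏' n, f n‖ = 1 := by
  by_cases hm : Multipliable f
  · have hP0 : Tendsto (fun s : Finset ℕ => ∏ n ∈ s, f n) atTop (𝓝 (∏' n, f n)) := hm.hasProd
    have hP := hP0.norm
    have h1 : (fun s : Finset ℕ => ‖∏ n ∈ s, f n‖) = fun _ => 1 := by
      funext s
      rw [norm_prod]
      exact Finset.prod_eq_one fun n _ => hf n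
    rw [h1] at hP
    exact tendsto_nhds_unique hP tendsto_const_nhds
  · rw [tprod_eq_one_of_not_multipliable hm, norm_one]

/-! ### §3 `2(ch(L) − 1) = L · (1 + O(p⁻¹))` on `‖L‖_p ≤ p⁻²` (`p` odd) -/

/-- Legendre at even arguments: `v_p((2(n+2))!) ≤ n + 1` for `p` odd (`(p−1)·v_p(m!) < m`).
[folklore] -/
theorem padicValNat_factorial_two_mul_add_two_le (hp2 : p ≠ 2) (n : ℕ) :
    padicValNat p (2 * (n + 2))! ≤ n + 1 := by
  have h := sub_one_mul_padicValNat_factorial_lt_of_ne_zero p (show 2 * (n + 2) ≠ 0 by omega)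
  have hp3 : 3 ≤ p := by
    have := hp.out.two_le
    omega
  have h2 : 2 * padicValNat p (2 * (n + 2))! < 2 * (n + 2) :=
    lt_of_le_of_lt (Nat.mul_le_mul_right _ (by omega)) h
  omega

/-- Legendre at even arguments, weak form valid for all `n`: `v_p((2n)!) ≤ n` for `p` odd. [folklore] -/
theorem padicValNat_factorial_two_mul_le (hp2 : p ≠ 2) (n : ℕ) : padicValNat p (2 * n)! ≤ n := by
  rcases Nat.eq_zero_or_pos n with rfl | hn
  · simp
  have h := sub_one_mul_padicValNat_factorial_lt_of_ne_zero p (show 2 * n ≠ 0 by omega)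
  have hp3 : 3 ≤ p := by
    have := hp.out.two_le
    omega
  have h2 : 2 * padicValNat p (2 * n)! < 2 * n :=
    lt_of_le_of_lt (Nat.mul_le_mul_right _ (by omega)) h
  omega

/-- The general term of `ch(L) = Σ Lⁿ/(2n)!` has norm `‖L‖ⁿ · p^{v_p((2n)!)}` (tree
`SteinWuthrich2013.norm_inv_factorial`). [folklore] -/
theorem norm_coshOfSq_term (L : ℚ_[p]) (n : ℕ) :
    ‖L ^ n / ((2 * n) ! : ℚ_[p])‖ = ‖L‖ ^ n * (p : ℝ) ^ (padicValNat p (2 * n)! : ℤ) := by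
  rw [div_eq_mul_inv, norm_mul, norm_pow, norm_inv_factorial]

/-- On `‖L‖_p ≤ p⁻²` (`p` odd) every term of `ch(L)` is bounded by the geometric sequence `p⁻ⁿ`:
`‖Lⁿ/(2n)!‖ ≤ ‖L‖ⁿ pⁿ ≤ (p⁻¹)ⁿ`. [folklore] -/
theorem norm_coshOfSq_term_le (hp2 : p ≠ 2) {L : ℚ_[p]} (hL : ‖L‖ ≤ ((p : ℝ)⁻¹) ^ 2) (n : ℕ) :
    ‖L ^ n / ((2 * n) ! : ℚ_[p])‖ ≤ ((p : ℝ)⁻¹) ^ n := by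
  have hp1 : (1 : ℝ) ≤ p := by exact_mod_cast hp.out.one_lt.le
  have hp0 : (0 : ℝ) < p := by positivity
  have hr0 : 0 ≤ ‖L‖ := norm_nonneg L
  rw [norm_coshOfSq_term]
  calc ‖L‖ ^ n * (p : ℝ) ^ (padicValNat p (2 * n)! : ℤ)
      ≤ ‖L‖ ^ n * (p : ℝ) ^ ((n : ℕ) : ℤ) := by
        refine mul_le_mul_of_nonneg_left ?_ (pow_nonneg hr0 n)
        exact zpow_le_zpow_right₀ hp1 (by exact_mod_cast padicValNat_factorial_two_mul_le hp2 n)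
    _ = (‖L‖ * p) ^ n := by rw [zpow_natCast, mul_pow]
    _ ≤ ((p : ℝ)⁻¹) ^ n := by
        refine pow_le_pow_left₀ (by positivity) ?_ n
        calc ‖L‖ * p ≤ ((p : ℝ)⁻¹) ^ 2 * p := mul_le_mul_of_nonneg_right hL hp0.le
          _ = (p : ℝ)⁻¹ := by field_simp

/-- The terms of `ch(L)` beyond `1 + L/2` are `O(‖L‖/p)`: `‖L^{n+2}/(2(n+2))!‖ ≤ ‖L‖·p⁻¹` for
`‖L‖_p ≤ p⁻²`, `p` odd (`v_p((2n+4)!) ≤ n + 1`). [folklore] -/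
theorem norm_coshOfSq_tail_term_le (hp2 : p ≠ 2) {L : ℚ_[p]} (hL : ‖L‖ ≤ ((p : ℝ)⁻¹) ^ 2) (n : ℕ) :
    ‖L ^ (n + 2) / ((2 * (n + 2)) ! : ℚ_[p])‖ ≤ ‖L‖ * (p : ℝ)⁻¹ := by
  have hp1 : (1 : ℝ) ≤ p := by exact_mod_cast hp.out.one_lt.le
  have hp0 : (0 : ℝ) < p := by positivity
  have hr0 : 0 ≤ ‖L‖ := norm_nonneg L
  have hpi1 : (p : ℝ)⁻¹ ≤ 1 := inv_le_one_of_one_le₀ hp1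
  rw [norm_coshOfSq_term]
  calc ‖L‖ ^ (n + 2) * (p : ℝ) ^ (padicValNat p (2 * (n + 2))! : ℤ)
      ≤ ‖L‖ ^ (n + 2) * (p : ℝ) ^ ((n + 1 : ℕ) : ℤ) := by
        refine mul_le_mul_of_nonneg_left ?_ (pow_nonneg hr0 _)
        exact zpow_le_zpow_right₀ hp1
          (by exact_mod_cast padicValNat_factorial_two_mul_add_two_le hp2 n)
    _ = ‖L‖ * (‖L‖ * p) ^ (n + 1) := by rw [zpow_natCast]; ring
    _ ≤ ‖L‖ * ((p : ℝ)⁻¹) ^ (n + 1) := by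
        refine mul_le_mul_of_nonneg_left (pow_le_pow_left₀ (by positivity) ?_ _) hr0
        calc ‖L‖ * p ≤ ((p : ℝ)⁻¹) ^ 2 * p := mul_le_mul_of_nonneg_right hL hp0.le
          _ = (p : ℝ)⁻¹ := by field_simp
    _ ≤ ‖L‖ * (p : ℝ)⁻¹ :=
        mul_le_mul_of_nonneg_left (pow_le_of_le_one (by positivity) hpi1 (by omega)) hr0

/-- **`ch(L) = 1 + L/2 + R` with `‖R‖_p ≤ ‖L‖_p/p`** for `‖L‖_p ≤ p⁻²`, `p` odd: the series
`Σ Lⁿ/(2n)!` is summable there (terms `≤ p⁻ⁿ`), its first two terms are `1` and `L/2`, and the tail is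
bounded by its largest term (ultrametric). [folklore] -/
theorem coshOfSq_eq_one_add_half_add (hp2 : p ≠ 2) {L : ℚ_[p]} (hL : ‖L‖ ≤ ((p : ℝ)⁻¹) ^ 2) :
    ∃ R : ℚ_[p], coshOfSq L = 1 + L / 2 + R ∧ ‖R‖ ≤ ‖L‖ * (p : ℝ)⁻¹ := by
  have hp1 : (1 : ℝ) < p := by exact_mod_cast hp.out.one_lt
  set t : ℕ → ℚ_[p] := fun n => L ^ n / ((2 * n) ! : ℚ_[p]) with ht
  have hsum : Summable t := by
    refine Summable.of_norm_bounded
      (summable_geometric_of_lt_one (by positivity) (inv_lt_one_of_one_lt₀ hp1)) fun n => ?_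
    exact norm_coshOfSq_term_le hp2 hL n
  refine ⟨∑' n, t (n + 2), ?_, ?_⟩
  · have h0 : coshOfSq L = ∑' n, t n := rfl
    rw [h0, hsum.tsum_eq_zero_add, ((summable_nat_add_iff 1).mpr hsum).tsum_eq_zero_add]
    have ht0 : t 0 = 1 := by simp [ht]
    have ht1 : t 1 = L / 2 := by simp [ht]
    rw [ht0, ht1, add_assoc]
  · refine norm_tsum_le_of_forall_le_of_nonneg (by positivity) fun n => ?_
    exact norm_coshOfSq_tail_term_le hp2 hL n

/-- **`‖ch(L)‖_p = 1`** for `‖L‖_p ≤ p⁻²`, `p` odd. [folklore] -/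
theorem norm_coshOfSq_eq_one (hp2 : p ≠ 2) {L : ℚ_[p]} (hL : ‖L‖ ≤ ((p : ℝ)⁻¹) ^ 2) :
    ‖coshOfSq L‖ = 1 := by
  have hp1 : (1 : ℝ) < p := by exact_mod_cast hp.out.one_lt
  have hpi : (p : ℝ)⁻¹ < 1 := inv_lt_one_of_one_lt₀ hp1
  obtain ⟨R, hR, hRle⟩ := coshOfSq_eq_one_add_half_add hp2 hL
  have h2 : ‖(2 : ℚ_[p])‖ = 1 := by
    simpa using Padic.norm_natCast_eq_one_iff.mpr ((Nat.coprime_primes hp.out Nat.prime_two).mpr hp2)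
  have hL1 : ‖L‖ < 1 := by
    refine hL.trans_lt ?_
    calc ((p : ℝ)⁻¹) ^ 2 ≤ (p : ℝ)⁻¹ := pow_le_of_le_one (by positivity) hpi.le (by norm_num)
      _ < 1 := hpi
  have h1 : ‖L / 2 + R‖ < 1 := by
    refine (norm_add_le_max _ _).trans_lt (max_lt ?_ ?_)
    · rw [norm_div, h2, div_one]; exact hL1
    · refine hRle.trans_lt ?_
      calc ‖L‖ * (p : ℝ)⁻¹ ≤ ‖L‖ * 1 := mul_le_mul_of_nonneg_left hpi.le (norm_nonneg _)
        _ < 1 := by rw [mul_one]; exact hL1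
  rw [hR, add_assoc]
  exact norm_one_add_eq_one_of_norm_lt_one h1

/-- **`‖2(ch(L) − 1)‖_p = ‖L‖_p`** for `‖L‖_p ≤ p⁻²`, `p` odd: `2(ch(L) − 1) = L + 2R` with
`‖2R‖ ≤ ‖L‖/p < ‖L‖` (or everything vanishes when `L = 0`). This is the cancellation that makes the
sigma value's valuation independent of the (transcendental) scale `C`. [folklore] -/
theorem norm_two_mul_coshOfSq_sub_one (hp2 : p ≠ 2) {L : ℚ_[p]} (hL : ‖L‖ ≤ ((p : ℝ)⁻¹) ^ 2) :
    ‖2 * (coshOfSq L - 1)‖ = ‖L‖ := by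
  have hp1 : (1 : ℝ) < p := by exact_mod_cast hp.out.one_lt
  have hpi : (p : ℝ)⁻¹ < 1 := inv_lt_one_of_one_lt₀ hp1
  obtain ⟨R, hR, hRle⟩ := coshOfSq_eq_one_add_half_add hp2 hL
  have h2n : ‖(2 : ℚ_[p])‖ = 1 := by
    simpa using Padic.norm_natCast_eq_one_iff.mpr ((Nat.coprime_primes hp.out Nat.prime_two).mpr hp2)
  have h2 : (2 : ℚ_[p]) ≠ 0 := norm_pos_iff.mp (by rw [h2n]; exact one_pos)
  have hkey : 2 * (coshOfSq L - 1) = L + 2 * R := by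
    rw [hR]
    field_simp
    ring
  have h2R : ‖2 * R‖ ≤ ‖L‖ * (p : ℝ)⁻¹ := by
    rw [norm_mul, h2n, one_mul]; exact hRle
  rw [hkey]
  rcases eq_or_ne L 0 with hL0 | hL0
  · have hR0 : 2 * R = 0 := by
      rw [← norm_le_zero_iff]
      refine h2R.trans ?_
      rw [hL0, norm_zero, zero_mul]
    rw [hR0, add_zero]
  · have hlt : ‖2 * R‖ < ‖L‖ := by
      refine h2R.trans_lt ?_
      calc ‖L‖ * (p : ℝ)⁻¹ < ‖L‖ * 1 := mul_lt_mul_of_pos_left hpi (norm_pos_iff.mpr hL0)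
        _ = ‖L‖ := mul_one _
    rw [norm_add_eq_max_of_norm_ne_norm (ne_of_gt hlt), max_eq_left hlt.le]

/-! ### §4 The `q`-product in `σ_q(u)²` is a `p`-adic unit -/

/-- Each factor `(1 − 2qⁿ⁺¹c + q^{2(n+1)})²/(1 − qⁿ⁺¹)⁴` of the product in `tateSigmaSq q c` has norm
`1` when `‖q‖_p < 1` and `‖c‖_p ≤ 1`. [cite: SteinWuthrich2013, §4.2] -/
theorem norm_tateSigmaSq_factor_eq_one {q c : ℚ_[p]} (hq : ‖q‖ < 1) (hc : ‖c‖ ≤ 1) (n : ℕ) :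
    ‖(1 - 2 * q ^ (n + 1) * c + q ^ (2 * (n + 1))) ^ 2 / (1 - q ^ (n + 1)) ^ 4‖ = 1 := by
  have hq1 : ‖q‖ ≤ 1 := hq.le
  have hqn : ‖q ^ (n + 1)‖ < 1 := by
    rw [norm_pow]; exact pow_lt_one₀ (norm_nonneg _) hq (Nat.succ_ne_zero n)
  have h2 : ‖(2 : ℚ_[p])‖ ≤ 1 := by
    have h : ((2 : ℤ) : ℚ_[p]) = 2 := by norm_cast
    rw [← h]; exact Padic.norm_int_le_one 2
  have hN : ‖1 - 2 * q ^ (n + 1) * c + q ^ (2 * (n + 1))‖ = 1 := by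
    have : 1 - 2 * q ^ (n + 1) * c + q ^ (2 * (n + 1)) =
        1 + (q ^ (2 * (n + 1)) + -(2 * q ^ (n + 1) * c)) := by ring
    rw [this]
    refine norm_one_add_eq_one_of_norm_lt_one ((norm_add_le_max _ _).trans_lt (max_lt ?_ ?_))
    · rw [norm_pow]
      exact pow_lt_one₀ (norm_nonneg _) hq (by omega)
    · rw [norm_neg, norm_mul, norm_mul]
      calc ‖(2 : ℚ_[p])‖ * ‖q ^ (n + 1)‖ * ‖c‖ ≤ 1 * ‖q ^ (n + 1)‖ * 1 := by
            gcongr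
        _ = ‖q ^ (n + 1)‖ := by ring
        _ < 1 := hqn
  have hD : ‖1 - q ^ (n + 1)‖ = 1 := by
    rw [sub_eq_add_neg]
    exact norm_one_add_eq_one_of_norm_lt_one (by rw [norm_neg]; exact hqn)
  rw [norm_div, norm_pow, norm_pow, hN, hD, one_pow, one_pow, div_one]

/-- **`‖σ-product‖ = 1`, hence `‖tateSigmaSq q c‖_p = ‖2(c − 1)‖_p`** for `‖q‖_p < 1`, `‖c‖_p ≤ 1`.
[cite: SteinWuthrich2013, §4.2] -/
theorem norm_tateSigmaSq_eq {q c : ℚ_[p]} (hq : ‖q‖ < 1) (hc : ‖c‖ ≤ 1) :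
    ‖tateSigmaSq q c‖ = ‖2 * (c - 1)‖ := by
  unfold tateSigmaSq
  rw [norm_mul, norm_tprod_eq_one_of_forall_norm_eq_one
    (fun n => norm_tateSigmaSq_factor_eq_one hq hc n), mul_one]

end Summit.BirchSwinnertonDyer.Uniform.UI.O2

end
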